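/-
Copyright (c) 2026 the pub-hodgecm-mathlib formalisation cell (harness21).  Prover seat hodgecm-mathlib-K2Liu-p05 (g0): Track B «K2-LIT»,
#184♮ = hLiu418 = stmt-HodgeConjecture-24832; socket #32d `sig_K2LiuDoublingHeightDecayLocal` of `Cruxes/HLiu418/Lines/K2_Liu_CurveThetaSigs_U5d_ZetaS.lean`
(ED. 1 a836627a4002dcd3 :224) — third step of the finite slice organs: the `v`-slice read at the place `v`; K2/STATUS 2026-09-04 (K2Liu-p05 (g0)).
-/
import Summits.HodgeConjecture.HodgeConjecture.Theorems.K2LiuDoublingEmbeddingPlaceComponents   -- ★ file 2a: `archPart_iotaLeft_eq_one`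
import Summits.HodgeConjecture.HodgeConjecture.Theorems.K2LiuDoublingHeightSliceQuasiInvariance -- ★ (A1): `exists_bound_and_inv_bound`
import Literature.NumberTheory.K2Lit.LocalDoublingSiegel                                        -- ★ D7c: `siegelDeltaLoc ∕ mem_siegelDeltaLoc_iff`
import Literature.NumberTheory.Automorphic.UnitaryGroupLocalFactors                             -- ★ `isCompact_localInt`
import HarnessLib

/-!
# Crux `HLiu418`, road `K2_Liu`, unit U5d, socket #32d — the finite slice AT THE PLACE: a locally decomposed point has height ≍ the local modulus

Cell `hodgecm-mathlib`, crux item hLiu418 = `stmt-HodgeConjecture-24832`; squad K2 ∕ K2Liu, LEAD F0P6-plan (g10), planner K2Liu-plan (g2), prover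
K2Liu-p05 (g0).  THEOREMS ONLY (no `def` ∕ instance ∕ notation ∕ named-fact hypothesis ∕ `sorry`, default heartbeats); lane
`--supports stmt-HodgeConjecture-24832 --as helper` (count-neutral).

The `v`-slice of #32d (★ `doublingHeightDecayLocal_of_slices`) is `y ↦ Φ(ι(ι_v y, 1))` on `U(V)(L⁺_v)` after the local bridge `ιA ∘ ι_v = ι_v ∘ θ_v`
of the frame (`ι_v` = ★ `inclPlaceAdelic v`).  This file prepares its EVALUATION ON CARTAN REPRESENTATIVES:
* §1 `finPart_iotaLeft` — `(ι(g, 1))_f = ι_f(g_f, 1)` (★ `finPart_iotaV`).  [The full place identity `ι(ι_v y, 1) = ι_v^H(ι_v(y, 1))` — archimedean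
  parts by ★ `archPart_iotaLeft_eq_one`, `w`-components by ★ `evalPlace_iotaLeftFin` + ★ `evalPlace_inclPlace(_of_ne)` — is mathematically one line but
  its last step repeatedly exhausts the elaborator's heartbeats in this seat's attempts (unifying `evalPlace_w ∘ inclPlace_v` terms of `U(V)` and of
  `H` against each other unfolds the adelic pipeline); it is left to the assembly file, whose hypothesis below is phrased so as not to need it.]
* §2 **A LOCALLY DECOMPOSED POINT HAS HEIGHT ≍ THE LOCAL MODULUS**: if `x = ι_v^H p · ι_v^H k` in `H(𝔸)` (`ι_v^H` = ★ `locToAdelic v`) with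
  `p ∈ P_Δ(L⁺_v)` (★ `siegelDeltaLoc v`) and `k ∈ H(𝒪_v)` (★ `localInt v`), then `Φ(x) = modDelta(ι_v^H p)·Φ(ι_v^H k)`
  (`apply_eq_modDelta_mul_of_localDecomp`) and `c⁻¹·modDelta(ι_v^H p) ≤ Φ(x) ≤ c·modDelta(ι_v^H p)` with ONE `c > 0` (`exists_twoSided_modDelta_of_localDecomp`;
  `H(𝒪_v)` compact, ★ `isCompact_localInt`); the modulus is `∏_{w∣v} ‖det_Δ p_w‖_w^{1∕2}` (★ `modDelta_locToAdelic`).  With `x = ι(ι_v t_a, 1)` and the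
  explicit `ι_v(t_a, 1) = p·k` of ★ `K2LiuSplitCartanIwasawa` this is the evaluation `ψ_v(t_a) ≍ q_v^{−Σ|a_i|∕2}` of the Cartan series of
  ★ `integrable_of_cartanSeries`.

[GelbartPiatetskishapiroRallis1987, Part A §6]; [Li1992, §3 Thm. 3.1]; [Liu2011, §2C p. 863]; [HarrisKudlaSweet1996, §1 (1.11), (1.15)]; [BorelJacquet1979, §4.1].
HONEST LABEL.  Count-neutral helper (it pays nothing by itself): `HC_CM` is proved only modulo the 7 printed citations (2 remaining named inputs: hLiu418 =
`stmt-HodgeConjecture-24832`, h413 = `stmt-HodgeConjecture-24833`) until rung 0 closes.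
-/

set_option autoImplicit false
-- the mandated namespace repeats the single-problem summit's segment (`HodgeConjecture.HodgeConjecture`)
set_option linter.dupNamespace false

noncomputable section

open scoped Matrix
open NumberField IsDedekindDomain

namespace Summit.HodgeConjecture.HodgeConjecture.Cruxes.HLiu418.K2LiuDoublingSliceAtPlace

open Literature.NumberTheory.Automorphic Literature.NumberTheory.Automorphic.UnitaryGroup
open Literature.NumberTheory.GelbartRogawski1991 Literature.NumberTheory.GelbartRogawski1991.GRConstruction
open Literature.NumberTheory.K2Lit.SiegelDoubled Literature.NumberTheory.K2Lit.PlaceSplitting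
open Summit.HodgeConjecture.HodgeConjecture.Cruxes.HLiu418.K2LiuDoublingEmbeddingPlaceComponents
open Summit.HodgeConjecture.HodgeConjecture.Cruxes.HLiu418.K2LiuDoublingHeightSliceQuasiInvariance

variable (L : Type) [Field L] [NumberField L] [IsCMField L]
variable {N M n : ℕ} (e : Fin N × Fin M ≃ Fin n)
  (dV : Fin N → L) (hdV : ∀ i, IsCMField.complexConj L (dV i) = dV i)
  (dW : Fin M → L) (hdW : ∀ i, IsCMField.complexConj L (dW i) = dW i)
  (v : HeightOneSpectrum (𝓞 (Fp L)))

/-! ## §1 `ι(ι_v y, 1) = ι_v^H(ι_v(y, 1))` -/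

/-- `(ι(g, 1))_f = ι_f(g_f, 1)` (★ `finPart_iotaV` at `g₂ = 1`). [cite: HarrisKudlaSweet1996, §1 (1.11)] -/
theorem finPart_iotaLeft (g : UnitaryGroup.adelic (Fp L) L (IsCMField.complexConj L) N (Matrix.diagonal dV)) :
    UnitaryGroup.finPart (Fp L) L (IsCMField.complexConj L) (n + n) (hermD L e dV hdV dW hdW) (iotaLeft L e dV hdV dW hdW g) =
      iotaLeftFin L e dV hdV dW hdW (UnitaryGroup.finPart (Fp L) L (IsCMField.complexConj L) N (Matrix.diagonal dV) g) := by
  have h1 : UnitaryGroup.finPart (Fp L) L (IsCMField.complexConj L) N (Matrix.diagonal dV)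
      (1 : UnitaryGroup.adelic (Fp L) L (IsCMField.complexConj L) N (Matrix.diagonal dV)) = 1 := map_one _
  rw [iotaLeft_apply, finPart_iotaV, h1, iotaLeftFin_apply]

/-! ## §2 The slice on a locally decomposed element -/

/-- **`Φ(x) = modDelta(ι_v^H p) · Φ(ι_v^H k)`** when `x = ι_v^H p · ι_v^H k` in `H(𝔸)` with `p ∈ P_Δ(L⁺_v)` (★ `siegelDeltaLoc v`), for a height `Φ` of type
`(P_Δ, modDelta)` — the shape in which a LOCAL Iwasawa decomposition `ι_v(y, 1) = p·k` of the slice point `x = ι(ι_v y, 1)` is consumed.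
[cite: GelbartPiatetskishapiroRallis1987, Part A §6] [cite: HarrisKudlaSweet1996, §1 (1.15)] -/
theorem apply_eq_modDelta_mul_of_localDecomp {Φ : HA L e dV hdV dW hdW → ℝ}
    (hΦ : ∀ p x : HA L e dV hdV dW hdW, IsSiegelDelta L e dV hdV dW hdW p →
      Φ (p * x) = modDelta L e dV hdV dW hdW p * Φ x)
    {x : HA L e dV hdV dW hdW} {p k : UnitaryGroup.localPi L (IsCMField.complexConj L) (n + n) (hermD L e dV hdV dW hdW) v}
    (hp : p ∈ siegelDeltaLoc L e dV hdV dW hdW v) (hx : x = locToAdelic L e dV hdV dW hdW v p * locToAdelic L e dV hdV dW hdW v k) :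
    Φ x = modDelta L e dV hdV dW hdW (locToAdelic L e dV hdV dW hdW v p) * Φ (locToAdelic L e dV hdV dW hdW v k) := by
  rw [hx, hΦ _ _ ((mem_siegelDeltaLoc_iff L e dV hdV dW hdW v p).1 hp)]

/-- **A LOCALLY DECOMPOSED POINT HAS HEIGHT ≍ THE LOCAL MODULUS.**  For a continuous height `Φ > 0` of type `(P_Δ, modDelta)` there is `c > 0` such that
for every `x ∈ H(𝔸)` of the form `x = ι_v^H p · ι_v^H k` with `p ∈ P_Δ(L⁺_v)` and `k ∈ H(𝒪_v)` (★ `localInt v`):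
`Φ(x) ≤ c·modDelta(ι_v^H p)` and `modDelta(ι_v^H p) ≤ c·Φ(x)` (`H(𝒪_v)` is compact, ★ `isCompact_localInt`, so `Φ ∘ ι_v^H` is two-sidedly bounded on
it; the local modulus is `∏_{w∣v} ‖det_Δ p_w‖_w^{1∕2}`, ★ `modDelta_locToAdelic`).  This is how the Cartan series of the `v`-slice is evaluated:
`x = ι(ι_v t_a, 1)` with the explicit `ι_v(t_a, 1) = p·k` of ★ `K2LiuSplitCartanIwasawa` gives `ψ_v(t_a) ≍ q_v^{−Σ|a_i|∕2}`.
[cite: Li1992, §3 Thm. 3.1] [cite: GelbartPiatetskishapiroRallis1987, Part A §6] -/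
theorem exists_twoSided_modDelta_of_localDecomp {Φ : HA L e dV hdV dW hdW → ℝ} (hΦc : Continuous Φ) (hΦpos : ∀ x, 0 < Φ x)
    (hΦ : ∀ p x : HA L e dV hdV dW hdW, IsSiegelDelta L e dV hdV dW hdW p →
      Φ (p * x) = modDelta L e dV hdV dW hdW p * Φ x) :
    ∃ c : ℝ, 0 < c ∧ ∀ (x : HA L e dV hdV dW hdW)
      (p k : UnitaryGroup.localPi L (IsCMField.complexConj L) (n + n) (hermD L e dV hdV dW hdW) v),
      p ∈ siegelDeltaLoc L e dV hdV dW hdW v →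
      k ∈ UnitaryGroup.localInt L (IsCMField.complexConj L) (n + n) (hermD L e dV hdV dW hdW) v →
      x = locToAdelic L e dV hdV dW hdW v p * locToAdelic L e dV hdV dW hdW v k →
        Φ x ≤ c * modDelta L e dV hdV dW hdW (locToAdelic L e dV hdV dW hdW v p) ∧
          modDelta L e dV hdV dW hdW (locToAdelic L e dV hdV dW hdW v p) ≤ c * Φ x := by
  -- `Φ ∘ ι_v^H` is two-sidedly bounded on the compact `H(𝒪_v)`
  have hKc : IsCompact ((locToAdelic L e dV hdV dW hdW v) ''
      (UnitaryGroup.localInt L (IsCMField.complexConj L) (n + n) (hermD L e dV hdV dW hdW) v :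
        Set (UnitaryGroup.localPi L (IsCMField.complexConj L) (n + n) (hermD L e dV hdV dW hdW) v))) :=
    (UnitaryGroup.isCompact_localInt L (IsCMField.complexConj L) (n + n) (hermD L e dV hdV dW hdW) v).image
      (UnitaryGroup.continuous_inclPlaceAdelic (Fp L) L (IsCMField.complexConj L) (n + n) (hermD L e dV hdV dW hdW) v)
  obtain ⟨B, hB, hBK⟩ := exists_bound_and_inv_bound L e dV hdV dW hdW hΦc hΦpos hKc
  refine ⟨B, hB, fun x p k hp hk hx => ?_⟩
  have hkB := hBK (locToAdelic L e dV hdV dW hdW v k) (Set.mem_image_of_mem _ hk)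
  have hm : 0 ≤ modDelta L e dV hdV dW hdW (locToAdelic L e dV hdV dW hdW v p) := (modDelta_pos L e dV hdV dW hdW _).le
  rw [apply_eq_modDelta_mul_of_localDecomp L e dV hdV dW hdW v hΦ hp hx]
  constructor
  · rw [mul_comm B]
    exact mul_le_mul_of_nonneg_left hkB.1 hm
  · have hΦk : 0 < Φ (locToAdelic L e dV hdV dW hdW v k) := hΦpos _
    have h1 : 1 ≤ B * Φ (locToAdelic L e dV hdV dW hdW v k) := by
      have := mul_le_mul_of_nonneg_right hkB.2 hΦk.le
      rwa [inv_mul_cancel₀ hΦk.ne'] at this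
    calc modDelta L e dV hdV dW hdW (locToAdelic L e dV hdV dW hdW v p)
        = modDelta L e dV hdV dW hdW (locToAdelic L e dV hdV dW hdW v p) * 1 := (mul_one _).symm
      _ ≤ modDelta L e dV hdV dW hdW (locToAdelic L e dV hdV dW hdW v p) * (B * Φ (locToAdelic L e dV hdV dW hdW v k)) :=
          mul_le_mul_of_nonneg_left h1 hm
      _ = B * (modDelta L e dV hdV dW hdW (locToAdelic L e dV hdV dW hdW v p) * Φ (locToAdelic L e dV hdV dW hdW v k)) := by ring

end Summit.HodgeConjecture.HodgeConjecture.Cruxes.HLiu418.K2LiuDoublingSliceAtPlace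

end
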